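import Literature.NumberTheory.Sieve.IwaniecAlmostPrimesVW
import HarnessLib

/-!
# Iwaniec (1978), §4: the arithmetic of the `W` main term and the sums over pairs — PROVED

H. Iwaniec, *Almost-primes represented by quadratic polynomials*, Invent. Math. 47 (1978)
171–188, §4 pp. 183–185.

Two groups of elementary facts used to assemble Proposition 1 from the evaluations of
`U`, `V`, `W` (`IwaniecAlmostPrimesLinearModel`, `IwaniecAlmostPrimesVW`):

* **The `W` main term.**  With `d = (n₁, n₂)`, `q = [n₁, n₂]` (squarefree) and
  `g(l₁, l₂) = [d₂ odd]/φ(d₂)`, `d₂ = d/(d, |l₁ − l₂|)` (`gfun`), the double sum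
  `G(L) = ∑_{l₁, l₂ < L} g(l₁, l₂)` satisfies `|G(L) − (L²/d) P(d)| ≤ L · P(d)` where
  `P(d) = ∑_{h mod d} g(h, 0)` is the number of odd divisors of `d` (`g` depends on `l₁ − l₂ mod d`
  only; each row is a sum of a `d`-periodic function), and `P(d) = ρ(d)` whenever `d` is squarefree
  with `ρ(d) ≠ 0` (then `ρ(p) = 2` for the odd `p ∣ d` and `ρ(2) = 1`).  Consequently
  (`abs_rho_gsum_sub_le`) `|(ρ(q)/q) G(L) − e₁ e₂ L²| ≤ e₁ e₂ d L`, `eᵢ = ρ(nᵢ)/nᵢ`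
  (`ρ(n₁)ρ(n₂) = ρ(q)ρ(d)`, `n₁ n₂ = q d`): the main term of `W` is `e₁ e₂ ∑_m (X/m)²`, which is
  what cancels against `2xV` and `x²U` (p. 184).
* **Sums over pairs** `n₁, n₂ ≤ K`: `∑∑ (n₁, n₂) ≤ K² (1 + log K)` and
  `∑∑ (n₁, n₂)/(n₁ n₂) ≤ (1 + log K)³` (`(a, b) ≤ ∑_{g ∣ a, g ∣ b} g` and interchange), and the
  logarithmic bound `|κ| ≤ 2 (1 + log E)` for the singular-series factor `kappa`.
-/

noncomputable section

open Finset Real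

namespace Literature.NumberTheory.Sieve.Iwaniec1978

/-! ### `g` as a `d`-periodic even function of `l₁ − l₂` -/

/-- The kernel `g_d(h) = [2 ∤ d/(d,h)] / φ(d/(d,h))` on `ℤ`. [cite: IwaniecInventiones1978, §4 p. 183] -/
def gker (d : ℕ) (h : ℤ) : ℝ :=
  if 2 ∣ d / Int.gcd d h then 0 else 1 / (Nat.totient (d / Int.gcd d h) : ℝ)

/-- `gfun d l₁ l₂ = g_d(l₁ − l₂)`. [folklore] -/
theorem gfun_eq_gker (d l₁ l₂ : ℕ) : gfun d l₁ l₂ = gker d ((l₁ : ℤ) - l₂) := by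
  unfold gfun dtwo gker
  rw [Int.gcd_eq_natAbs_gcd_natAbs, Int.natAbs_natCast]

/-- `g_d` is `d`-periodic. [folklore] -/
theorem gker_add_self (d : ℕ) (h : ℤ) : gker d (h + d) = gker d h := by
  unfold gker; rw [Int.gcd_add_self_right]

/-- `g_d` is `d`-periodic (subtractive form). [folklore] -/
theorem gker_sub_self (d : ℕ) (h : ℤ) : gker d (h - d) = gker d h := by
  unfold gker; rw [Int.gcd_sub_self_right]

/-- `g_d ≥ 0`. [folklore] -/
theorem gker_nonneg (d : ℕ) (h : ℤ) : 0 ≤ gker d h := by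
  unfold gker; split_ifs <;> positivity

/-! ### Sums of periodic functions -/

/-- A nonnegative `d`-periodic function summed over `0 ≤ l < L` equals `(L/d) · (period sum)` up to
one period sum. [folklore] -/
theorem abs_sum_range_sub_le_of_periodic {F : ℕ → ℝ} {d : ℕ} (hd : 0 < d)
    (hper : ∀ l, F (l + d) = F l) (h0 : ∀ l, 0 ≤ F l) (L : ℕ) :
    |∑ l ∈ Finset.range L, F l - (L : ℝ) / d * ∑ l ∈ Finset.range d, F l| ≤
      ∑ l ∈ Finset.range d, F l := by
  set P := ∑ l ∈ Finset.range d, F l with hP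
  have hP0 : 0 ≤ P := Finset.sum_nonneg fun l _ => h0 l
  have hperk : ∀ k l, F (l + d * k) = F l := by
    intro k
    induction k with
    | zero => intro l; simp
    | succ k ih => intro l; rw [Nat.mul_succ, ← add_assoc, hper, ih]
  have hblock : ∀ k, ∑ l ∈ Finset.range (d * k), F l = k * P := by
    intro k
    induction k with
    | zero => simp
    | succ k ih =>
      rw [Nat.mul_succ, Finset.sum_range_add, ih]
      have : ∑ l ∈ Finset.range d, F (d * k + l) = P := by
        rw [hP]; exact Finset.sum_congr rfl fun l _ => by rw [add_comm, hperk]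
      rw [this]; push_cast; ring
  have hL : L = d * (L / d) + L % d := (Nat.div_add_mod L d).symm
  have hr : L % d < d := Nat.mod_lt L hd
  have hrest : ∑ l ∈ Finset.range (L % d), F (d * (L / d) + l) =
      ∑ l ∈ Finset.range (L % d), F l :=
    Finset.sum_congr rfl fun l _ => by rw [add_comm, hperk]
  have hrest_le : ∑ l ∈ Finset.range (L % d), F l ≤ P :=
    Finset.sum_le_sum_of_subset_of_nonneg (Finset.range_subset_range.mpr hr.le) fun l _ _ => h0 l
  have hrest0 : 0 ≤ ∑ l ∈ Finset.range (L % d), F l := Finset.sum_nonneg fun l _ => h0 l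
  have hsum : ∑ l ∈ Finset.range L, F l =
      ((L / d : ℕ) : ℝ) * P + ∑ l ∈ Finset.range (L % d), F l := by
    conv_lhs => rw [hL]
    rw [Finset.sum_range_add, hblock, hrest]
  have hd' : (0 : ℝ) < d := by exact_mod_cast hd
  have hLd : (L : ℝ) / d = ((L / d : ℕ) : ℝ) + ((L % d : ℕ) : ℝ) / d := by
    have hc := congrArg (Nat.cast : ℕ → ℝ) hL
    push_cast at hc
    rw [div_eq_iff hd'.ne', add_mul, div_mul_cancel₀ _ hd'.ne', hc]
    ring
  have hfrac1 : ((L % d : ℕ) : ℝ) / d < 1 := by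
    rw [div_lt_one hd']; exact_mod_cast hr
  have hfrac0 : 0 ≤ ((L % d : ℕ) : ℝ) / d := by positivity
  rw [hsum, hLd]
  have : ((L / d : ℕ) : ℝ) * P + ∑ l ∈ Finset.range (L % d), F l -
      (((L / d : ℕ) : ℝ) + ((L % d : ℕ) : ℝ) / d) * P =
      ∑ l ∈ Finset.range (L % d), F l - ((L % d : ℕ) : ℝ) / d * P := by ring
  rw [this, abs_le]
  constructor
  · have : ((L % d : ℕ) : ℝ) / d * P ≤ 1 * P := mul_le_mul_of_nonneg_right hfrac1.le hP0
    linarith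
  · have : 0 ≤ ((L % d : ℕ) : ℝ) / d * P := mul_nonneg hfrac0 hP0
    linarith

/-- The sum of a `d`-periodic function on `ℤ` over a window of `d` consecutive integers does not
depend on the window. [folklore] -/
theorem sum_range_add_eq_of_periodic {F : ℤ → ℝ} {d : ℕ} (hper : ∀ h, F (h + d) = F h) (a : ℤ) :
    ∑ j ∈ Finset.range d, F (a + j) = ∑ j ∈ Finset.range d, F j := by
  have hstep : ∀ a : ℤ, ∑ j ∈ Finset.range d, F (a + 1 + j) = ∑ j ∈ Finset.range d, F (a + j) := by
    intro a
    rcases Nat.eq_zero_or_pos d with hd | hd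
    · subst hd; simp
    · obtain ⟨d', rfl⟩ : ∃ d', d = d' + 1 := ⟨d - 1, by omega⟩
      rw [Finset.sum_range_succ, Finset.sum_range_succ']
      have h1 : F (a + 1 + ((d' : ℕ) : ℤ)) = F (a + ((0 : ℕ) : ℤ)) := by
        have := hper a
        push_cast at this ⊢
        rw [show a + 1 + (d' : ℤ) = a + ((d' : ℤ) + 1) by ring, this, add_zero]
      rw [h1]
      congr 1
      exact Finset.sum_congr rfl fun j _ => by congr 1; push_cast; ring
  induction a using Int.induction_on with
  | zero => simp
  | succ i ih => rw [hstep, ih]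
  | pred i ih =>
    have h := hstep (-(i : ℤ) - 1)
    rw [show -(i : ℤ) - 1 + 1 = -i by ring] at h
    rw [← ih, ← h]

/-- The same for the reflected window `a − j`, `0 ≤ j < d`. [folklore] -/
theorem sum_range_sub_eq_of_periodic {F : ℤ → ℝ} {d : ℕ} (hper : ∀ h, F (h + d) = F h) (a : ℤ) :
    ∑ j ∈ Finset.range d, F (a - j) = ∑ j ∈ Finset.range d, F j := by
  have h := sum_range_add_eq_of_periodic hper (a - d + 1)
  rw [← h]
  conv_lhs => rw [← Finset.sum_range_reflect]
  refine Finset.sum_congr rfl fun j hj => ?_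
  rw [Finset.mem_range] at hj
  congr 1
  rw [Nat.cast_sub (by omega : j ≤ d - 1), Nat.cast_sub (by omega : 1 ≤ d)]
  push_cast; ring

/-! ### The period sum `P(d)` and the double sum `G(L)` -/

/-- `P(d) = ∑_{0 ≤ h < d} g_d(h)`. [cite: IwaniecInventiones1978, §4 p. 184] -/
def gPeriod (d : ℕ) : ℝ := ∑ j ∈ Finset.range d, gker d j

/-- `P(d) ≥ 0`. [folklore] -/
theorem gPeriod_nonneg (d : ℕ) : 0 ≤ gPeriod d := Finset.sum_nonneg fun j _ => gker_nonneg d j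

/-- One row of `G(L)`: `|∑_{l₂<L} g(l₁, l₂) − (L/d) P(d)| ≤ P(d)`. [folklore] -/
theorem abs_sum_gfun_row_sub_le {d : ℕ} (hd : 0 < d) (l₁ L : ℕ) :
    |∑ l₂ ∈ Finset.range L, gfun d l₁ l₂ - (L : ℝ) / d * gPeriod d| ≤ gPeriod d := by
  set F : ℕ → ℝ := fun l₂ => gker d ((l₁ : ℤ) - l₂) with hF
  have hFper : ∀ l, F (l + d) = F l := by
    intro l
    simp only [hF]
    push_cast
    rw [show (l₁ : ℤ) - (l + d) = (l₁ - l) - d by ring, gker_sub_self]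
  have hF0 : ∀ l, 0 ≤ F l := fun l => gker_nonneg _ _
  have hFP : ∑ l ∈ Finset.range d, F l = gPeriod d := by
    simp only [hF]
    exact sum_range_sub_eq_of_periodic (gker_add_self d) l₁
  have h := abs_sum_range_sub_le_of_periodic hd hFper hF0 L
  rw [hFP] at h
  have hrow : ∑ l₂ ∈ Finset.range L, gfun d l₁ l₂ = ∑ l₂ ∈ Finset.range L, F l₂ :=
    Finset.sum_congr rfl fun l₂ _ => gfun_eq_gker d l₁ l₂
  rw [hrow]; exact h

/-- **`|G(L) − (L²/d) P(d)| ≤ L P(d)`**, `G(L) = ∑_{l₁, l₂ < L} g(l₁, l₂)`.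
[cite: IwaniecInventiones1978, §4 p. 184] -/
theorem abs_gsum_sub_le {d : ℕ} (hd : 0 < d) (L : ℕ) :
    |∑ l₁ ∈ Finset.range L, ∑ l₂ ∈ Finset.range L, gfun d l₁ l₂ - (L : ℝ) ^ 2 / d * gPeriod d| ≤
      L * gPeriod d := by
  have : ∑ l₁ ∈ Finset.range L, ∑ l₂ ∈ Finset.range L, gfun d l₁ l₂ - (L : ℝ) ^ 2 / d * gPeriod d =
      ∑ l₁ ∈ Finset.range L, (∑ l₂ ∈ Finset.range L, gfun d l₁ l₂ - (L : ℝ) / d * gPeriod d) := by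
    rw [Finset.sum_sub_distrib, Finset.sum_const, Finset.card_range, nsmul_eq_mul]; ring
  rw [this]
  calc _ ≤ ∑ l₁ ∈ Finset.range L, |∑ l₂ ∈ Finset.range L, gfun d l₁ l₂ - (L : ℝ) / d * gPeriod d| :=
        Finset.abs_sum_le_sum_abs _ _
    _ ≤ ∑ l₁ ∈ Finset.range L, gPeriod d :=
        Finset.sum_le_sum fun l₁ _ => abs_sum_gfun_row_sub_le hd l₁ L
    _ = _ := by rw [Finset.sum_const, Finset.card_range, nsmul_eq_mul]

/-- **`P(d)` is the number of odd divisors of `d`** (group `h mod d` by `(d, h) = t`: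
`φ(d/t)` classes, each contributing `[2 ∤ d/t]/φ(d/t)`). [folklore] -/
theorem gPeriod_eq_card {d : ℕ} (hd : 0 < d) :
    gPeriod d = ((d.divisors.filter (fun t => ¬ 2 ∣ t)).card : ℝ) := by
  unfold gPeriod
  have h1 : ∀ j ∈ Finset.range d, gker d j =
      (if 2 ∣ d / Nat.gcd d j then 0 else 1 / (Nat.totient (d / Nat.gcd d j) : ℝ)) := by
    intro j _; unfold gker; rw [Int.gcd_natCast_natCast]
  rw [Finset.sum_congr rfl h1]
  rw [← Finset.sum_fiberwise_of_maps_to (s := Finset.range d) (t := d.divisors)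
    (g := fun j => Nat.gcd d j) (fun j _ => Nat.mem_divisors.mpr ⟨Nat.gcd_dvd_left d j, hd.ne'⟩)]
  have h2 : ∀ t ∈ d.divisors, ∑ j ∈ (Finset.range d).filter (fun j => Nat.gcd d j = t),
      (if 2 ∣ d / Nat.gcd d j then 0 else 1 / (Nat.totient (d / Nat.gcd d j) : ℝ)) =
      if 2 ∣ d / t then 0 else 1 := by
    intro t ht
    have htd : t ∣ d := Nat.dvd_of_mem_divisors ht
    have hsum : ∑ j ∈ (Finset.range d).filter (fun j => Nat.gcd d j = t),
        (if 2 ∣ d / Nat.gcd d j then 0 else 1 / (Nat.totient (d / Nat.gcd d j) : ℝ)) =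
        ∑ j ∈ (Finset.range d).filter (fun j => Nat.gcd d j = t),
          (if 2 ∣ d / t then 0 else 1 / (Nat.totient (d / t) : ℝ)) := by
      refine Finset.sum_congr rfl fun j hj => ?_
      rw [Finset.mem_filter] at hj
      rw [hj.2]
    rw [hsum, Finset.sum_const, nsmul_eq_mul, ← Nat.totient_div_of_dvd htd]
    have hφ : (0 : ℝ) < Nat.totient (d / t) := by
      exact_mod_cast Nat.totient_pos.mpr
        (Nat.div_pos (Nat.le_of_dvd hd htd) (Nat.pos_of_mem_divisors ht))
    split_ifs
    · rw [mul_zero]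
    · field_simp
  rw [Finset.sum_congr rfl h2]
  have h3 := Nat.sum_div_divisors d (fun t => if 2 ∣ t then (0 : ℝ) else 1)
  rw [h3, Finset.sum_ite, Finset.sum_const_zero, Finset.sum_const, zero_add, nsmul_eq_mul, mul_one]

/-! ### `P(d) = ρ(d)` for squarefree `d` with `ρ(d) ≠ 0` -/

/-- The indicator of the odd numbers as a real arithmetic function. [folklore] -/
def oddIndA : ArithmeticFunction ℝ := ⟨fun n => if n % 2 = 1 then 1 else 0, by simp⟩

/-- Unfolding `oddIndA`. [folklore] -/
theorem oddIndA_apply (n : ℕ) : oddIndA n = if n % 2 = 1 then 1 else 0 := rfl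

/-- `oddIndA` is multiplicative. [folklore] -/
theorem isMultiplicative_oddIndA : oddIndA.IsMultiplicative := by
  refine ⟨by simp [oddIndA_apply], fun {m n} _ => ?_⟩
  simp only [oddIndA_apply, Nat.mul_mod m n 2]
  rcases Nat.mod_two_eq_zero_or_one m with hm | hm <;>
    rcases Nat.mod_two_eq_zero_or_one n with hn | hn <;> simp [hm, hn]

/-- The number of odd divisors, `ζ * oddIndA`, as a real arithmetic function. [folklore] -/
def oddDivCountA : ArithmeticFunction ℝ :=
  (ArithmeticFunction.zeta : ArithmeticFunction ℝ) * oddIndA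

/-- `oddDivCountA n = #{t ∣ n : t odd}`. [folklore] -/
theorem oddDivCountA_apply (n : ℕ) :
    oddDivCountA n = ((n.divisors.filter (fun t => ¬ 2 ∣ t)).card : ℝ) := by
  unfold oddDivCountA
  rw [ArithmeticFunction.coe_zeta_mul_apply]
  simp only [oddIndA_apply]
  rw [Finset.sum_boole]
  congr 2
  exact Finset.filter_congr fun t _ => Nat.two_dvd_ne_zero.symm

/-- `oddDivCountA` is multiplicative. [folklore] -/
theorem isMultiplicative_oddDivCountA : oddDivCountA.IsMultiplicative :=
  ArithmeticFunction.isMultiplicative_zeta.natCast.mul isMultiplicative_oddIndA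

/-- `ρ(n) μ²(n) #{odd t ∣ n} = ρ(n)² μ²(n)` for all `n` (both sides are multiplicative; at a prime
`p`: `ρ(2) = 1`, one odd divisor; `p` odd: two odd divisors and `ρ(p) ∈ {0, 2}`). [folklore] -/
theorem rho_mul_oddDivCount (n : ℕ) :
    (rho n : ℝ) * (moebiusSq n * oddDivCountA n) = (rho n : ℝ) * ((rho n : ℝ) * moebiusSq n) := by
  have h : rhoArith.pmul (moebiusSq.pmul oddDivCountA) =
      rhoArith.pmul (rhoArith.pmul moebiusSq) := by
    rw [(isMultiplicative_rhoArith.pmul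
        (isMultiplicative_moebiusSq.pmul isMultiplicative_oddDivCountA)).eq_iff_eq_on_prime_powers
      _ _ (isMultiplicative_rhoArith.pmul (isMultiplicative_rhoArith.pmul isMultiplicative_moebiusSq))]
    intro p i hp
    simp only [ArithmeticFunction.pmul_apply, rhoArith_apply, moebiusSq_primePow hp]
    rcases i with _ | _ | i
    · simp [rho_one, oddDivCountA_apply, Finset.filter_singleton]
    · simp only [zero_add, pow_one, le_refl, if_true, one_mul, mul_one]
      rw [oddDivCountA_apply, hp.divisors]
      by_cases hp2 : p = 2
      · subst hp2
        rw [rho_two]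
        norm_num [Finset.filter_insert, Finset.filter_singleton]
      · have hcard : (({1, p} : Finset ℕ).filter (fun t => ¬ 2 ∣ t)).card = 2 := by
          rw [Finset.filter_true_of_mem, Finset.card_pair hp.one_lt.ne]
          intro t ht
          simp only [Finset.mem_insert, Finset.mem_singleton] at ht
          rcases ht with rfl | rfl
          · omega
          · intro h2
            exact hp2 ((Nat.prime_dvd_prime_iff_eq Nat.prime_two hp).mp h2).symm
        rw [hcard]
        have hρ := rho_odd_primePow_eq_ite hp hp2 one_ne_zero
        rw [pow_one] at hρ
        split_ifs at hρ
        · rw [hρ]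
        · rw [hρ]; norm_num
    · have h2 : ¬ (i + 2 ≤ 1) := by omega
      simp [h2]
  have := congrArg (fun f : ArithmeticFunction ℝ => f n) h
  simpa only [ArithmeticFunction.pmul_apply, rhoArith_apply] using this

/-- **`#{odd t ∣ d} = ρ(d)`** for squarefree `d` with `ρ(d) ≠ 0`. [folklore] -/
theorem card_odd_divisors_eq_rho {d : ℕ} (hd : Squarefree d) (hρ : rho d ≠ 0) :
    ((d.divisors.filter (fun t => ¬ 2 ∣ t)).card : ℝ) = rho d := by
  have h := rho_mul_oddDivCount d
  have hsq : moebiusSq d = 1 := by simp [moebiusSq_apply, hd]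
  rw [hsq, one_mul, mul_one] at h
  have hρ' : (rho d : ℝ) ≠ 0 := by exact_mod_cast hρ
  have := mul_left_cancel₀ hρ' h
  rw [oddDivCountA_apply] at this
  exact this

/-- **The `W` main term**: for squarefree `n₁, n₂`, `d = (n₁,n₂)`, `q = [n₁,n₂]`, `eᵢ = ρ(nᵢ)/nᵢ`,
`|(ρ(q)/q) G(L) − e₁ e₂ L²| ≤ e₁ e₂ d L` (`ρ(q) P(d) = ρ(q) ρ(d)`, `ρ(q)ρ(d) = ρ(n₁)ρ(n₂)`,
`q d = n₁ n₂`). [cite: IwaniecInventiones1978, §4 p. 184] -/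
theorem abs_rho_gsum_sub_le {n₁ n₂ : ℕ} (hn₁ : Squarefree n₁) (hn₂ : Squarefree n₂) (L : ℕ) :
    |(rho (Nat.lcm n₁ n₂) : ℝ) / Nat.lcm n₁ n₂ *
        ∑ l₁ ∈ Finset.range L, ∑ l₂ ∈ Finset.range L, gfun (Nat.gcd n₁ n₂) l₁ l₂ -
      (rho n₁ : ℝ) / n₁ * ((rho n₂ : ℝ) / n₂) * (L : ℝ) ^ 2| ≤
      (rho n₁ : ℝ) / n₁ * ((rho n₂ : ℝ) / n₂) * Nat.gcd n₁ n₂ * L := by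
  have hn₁0 : n₁ ≠ 0 := hn₁.ne_zero
  have hn₂0 : n₂ ≠ 0 := hn₂.ne_zero
  set d := Nat.gcd n₁ n₂ with hd
  set q := Nat.lcm n₁ n₂ with hq
  have hdpos : 0 < d := Nat.gcd_pos_of_pos_left _ (Nat.pos_of_ne_zero hn₁0)
  have hq0 : q ≠ 0 := Nat.lcm_ne_zero hn₁0 hn₂0
  have hqsf : Squarefree q := by
    obtain ⟨hcop, hlcm⟩ := coprime_div_gcd_of_squarefree hn₂ hn₁0
    rw [hq, hlcm, Nat.squarefree_mul_iff]
    exact ⟨hcop, hn₁, hn₂.squarefree_of_dvd (Nat.div_dvd_of_dvd (Nat.gcd_dvd_right _ _))⟩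
  have hdq : d ∣ q := (Nat.gcd_dvd_left n₁ n₂).trans (Nat.dvd_lcm_left n₁ n₂)
  have hqd : (q : ℝ) * d = n₁ * n₂ := by
    have := Nat.gcd_mul_lcm n₁ n₂
    rw [← hd, ← hq, mul_comm] at this
    exact_mod_cast this
  have hρρ : (rho q : ℝ) * rho d = rho n₁ * rho n₂ := by
    exact_mod_cast (rho_mul_rho_eq hn₁ hn₂).symm
  have hn₁' : (n₁ : ℝ) ≠ 0 := by exact_mod_cast hn₁0
  have hn₂' : (n₂ : ℝ) ≠ 0 := by exact_mod_cast hn₂0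
  have hq' : (q : ℝ) ≠ 0 := by exact_mod_cast hq0
  have hd' : (d : ℝ) ≠ 0 := by exact_mod_cast hdpos.ne'
  have he : (rho n₁ : ℝ) / n₁ * ((rho n₂ : ℝ) / n₂) = (rho q : ℝ) * rho d / (q * d) := by
    rw [hqd, hρρ]; field_simp
  by_cases hρq : rho q = 0
  · have h0 : (rho n₁ : ℝ) / n₁ * ((rho n₂ : ℝ) / n₂) = 0 := by rw [he, hρq]; simp
    rw [h0, hρq]; simp
  · have hρd : rho d ≠ 0 := by
      intro h0; apply hρq
      have := rho_div_mul_rho hqsf hdq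
      rw [h0, mul_zero] at this
      exact this.symm
    have hdsf : Squarefree d := hn₁.squarefree_of_dvd (Nat.gcd_dvd_left _ _)
    have hP : gPeriod d = rho d := by rw [gPeriod_eq_card hdpos, card_odd_divisors_eq_rho hdsf hρd]
    have hG := abs_gsum_sub_le hdpos L
    rw [hP] at hG
    have hc : 0 ≤ (rho q : ℝ) / q := by positivity
    calc |(rho q : ℝ) / q * ∑ l₁ ∈ Finset.range L, ∑ l₂ ∈ Finset.range L, gfun d l₁ l₂ -
            (rho n₁ : ℝ) / n₁ * ((rho n₂ : ℝ) / n₂) * (L : ℝ) ^ 2|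
        = |(rho q : ℝ) / q * (∑ l₁ ∈ Finset.range L, ∑ l₂ ∈ Finset.range L, gfun d l₁ l₂ -
            (L : ℝ) ^ 2 / d * rho d)| := by
          congr 1; rw [he]; field_simp
      _ = (rho q : ℝ) / q * |∑ l₁ ∈ Finset.range L, ∑ l₂ ∈ Finset.range L, gfun d l₁ l₂ -
            (L : ℝ) ^ 2 / d * rho d| := by rw [abs_mul, abs_of_nonneg hc]
      _ ≤ (rho q : ℝ) / q * (L * rho d) := mul_le_mul_of_nonneg_left hG hc
      _ = _ := by rw [he]; field_simp

/-! ### Sums over pairs `n₁, n₂ ≤ K` -/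

/-- `(a, b) ≤ ∑_{g ≤ K, g ∣ a, g ∣ b} g` for `1 ≤ a ≤ K`. [folklore] -/
theorem gcd_le_sum_ite_dvd {a b K : ℕ} (ha : a ∈ Finset.Icc 1 K) :
    (Nat.gcd a b : ℝ) ≤ ∑ g ∈ Finset.Icc 1 K, if g ∣ a ∧ g ∣ b then (g : ℝ) else 0 := by
  rw [Finset.mem_Icc] at ha
  have hg : Nat.gcd a b ∈ Finset.Icc 1 K := by
    rw [Finset.mem_Icc]
    exact ⟨Nat.gcd_pos_of_pos_left _ (by omega), (Nat.gcd_le_left b (by omega)).trans ha.2⟩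
  calc (Nat.gcd a b : ℝ) = if Nat.gcd a b ∣ a ∧ Nat.gcd a b ∣ b then (Nat.gcd a b : ℝ) else 0 := by
        rw [if_pos ⟨Nat.gcd_dvd_left a b, Nat.gcd_dvd_right a b⟩]
    _ ≤ ∑ g ∈ Finset.Icc 1 K, if g ∣ a ∧ g ∣ b then (g : ℝ) else 0 :=
        Finset.single_le_sum (f := fun g => if g ∣ a ∧ g ∣ b then (g : ℝ) else 0)
          (fun g _ => by positivity) hg

/-- The multiples of `g ≥ 1` in `[1, K]` are `g · [1, K/g]`. [folklore] -/
theorem filter_dvd_Icc_eq_map {g : ℕ} (hg : 0 < g) (K : ℕ) :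
    (Finset.Icc 1 K).filter (fun a => g ∣ a) =
      (Finset.Icc 1 (K / g)).map ⟨fun j => g * j, mul_right_injective₀ hg.ne'⟩ := by
  ext a
  simp only [Finset.mem_filter, Finset.mem_Icc, Finset.mem_map, Function.Embedding.coeFn_mk]
  constructor
  · rintro ⟨⟨h1, h2⟩, ⟨j, rfl⟩⟩
    refine ⟨j, ⟨?_, ?_⟩, rfl⟩
    · rcases Nat.eq_zero_or_pos j with rfl | hj
      · simp at h1
      · exact hj
    · rw [Nat.le_div_iff_mul_le hg, mul_comm]; exact h2
  · rintro ⟨j, ⟨h1, h2⟩, rfl⟩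
    refine ⟨⟨Nat.mul_pos hg h1, ?_⟩, dvd_mul_right g j⟩
    rw [Nat.le_div_iff_mul_le hg, mul_comm] at h2; exact h2

/-- `∑_{a ≤ K, g ∣ a} F(a) = ∑_{j ≤ K/g} F(g j)`. [folklore] -/
theorem sum_filter_dvd_Icc {g : ℕ} (hg : 0 < g) (K : ℕ) (F : ℕ → ℝ) :
    ∑ a ∈ (Finset.Icc 1 K).filter (fun a => g ∣ a), F a = ∑ j ∈ Finset.Icc 1 (K / g), F (g * j) := by
  rw [filter_dvd_Icc_eq_map hg K, Finset.sum_map]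
  rfl

/-- `∑_{a ≤ K} 1/a ≤ 1 + log K`. [folklore] -/
theorem sum_Icc_inv_le_log (K : ℕ) : ∑ a ∈ Finset.Icc 1 K, (1 : ℝ) / a ≤ 1 + Real.log K := by
  rcases Nat.eq_zero_or_pos K with rfl | hK
  · simp
  · have := harmonic_le_one_add_log K
    rw [harmonic_eq_sum_Icc] at this
    push_cast at this
    simpa [one_div] using this

/-- The interchange behind the pair sums: for weights `w` and `F`,
`∑_{a,b ≤ K} F(a) F(b) ∑_{g ≤ K, g∣a, g∣b} w(g) = ∑_{g ≤ K} w(g) (∑_{a ≤ K, g ∣ a} F(a))²`. [folklore] -/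
theorem sum_sum_sum_ite_dvd_eq (K : ℕ) (w F : ℕ → ℝ) :
    ∑ a ∈ Finset.Icc 1 K, ∑ b ∈ Finset.Icc 1 K,
        F a * F b * ∑ g ∈ Finset.Icc 1 K, (if g ∣ a ∧ g ∣ b then w g else 0) =
      ∑ g ∈ Finset.Icc 1 K, w g * (∑ a ∈ (Finset.Icc 1 K).filter (fun a => g ∣ a), F a) ^ 2 := by
  have h1 : ∀ a ∈ Finset.Icc 1 K, ∀ b ∈ Finset.Icc 1 K,
      F a * F b * ∑ g ∈ Finset.Icc 1 K, (if g ∣ a ∧ g ∣ b then w g else 0) =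
        ∑ g ∈ Finset.Icc 1 K, w g * ((if g ∣ a then F a else 0) * (if g ∣ b then F b else 0)) := by
    intro a _ b _
    rw [Finset.mul_sum]
    refine Finset.sum_congr rfl fun g _ => ?_
    by_cases ha : g ∣ a <;> by_cases hb : g ∣ b <;> simp [ha, hb]
    ring
  rw [Finset.sum_congr rfl fun a ha => Finset.sum_congr rfl fun b hb => h1 a ha b hb]
  rw [Finset.sum_comm]
  refine (Finset.sum_congr rfl fun a _ => Finset.sum_comm).trans ?_
  rw [Finset.sum_comm]
  refine Finset.sum_congr rfl fun g _ => ?_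
  rw [Finset.sum_filter, sq, Finset.sum_mul_sum, Finset.mul_sum]
  refine Finset.sum_congr rfl fun a _ => ?_
  rw [Finset.mul_sum]
  refine Finset.sum_congr rfl fun b _ => ?_
  ring

/-- **`∑_{a, b ≤ K} (a, b) ≤ K² (1 + log K)`**. [folklore] -/
theorem sum_sum_gcd_le (K : ℕ) :
    ∑ a ∈ Finset.Icc 1 K, ∑ b ∈ Finset.Icc 1 K, (Nat.gcd a b : ℝ) ≤
      (K : ℝ) ^ 2 * (1 + Real.log K) := by
  have h1 : ∑ a ∈ Finset.Icc 1 K, ∑ b ∈ Finset.Icc 1 K, (Nat.gcd a b : ℝ) ≤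
      ∑ a ∈ Finset.Icc 1 K, ∑ b ∈ Finset.Icc 1 K,
        (fun _ => (1 : ℝ)) a * (fun _ => (1 : ℝ)) b *
          ∑ g ∈ Finset.Icc 1 K, (if g ∣ a ∧ g ∣ b then (g : ℝ) else 0) := by
    refine Finset.sum_le_sum fun a ha => Finset.sum_le_sum fun b _ => ?_
    simp only [one_mul]
    exact gcd_le_sum_ite_dvd ha
  refine h1.trans ?_
  rw [sum_sum_sum_ite_dvd_eq K (fun g => (g : ℝ)) (fun _ => (1 : ℝ))]
  have h2 : ∀ g ∈ Finset.Icc 1 K,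
      (g : ℝ) * (∑ a ∈ (Finset.Icc 1 K).filter (fun a => g ∣ a), (fun _ => (1 : ℝ)) a) ^ 2 ≤
        (K : ℝ) ^ 2 * (1 / g) := by
    intro g hg
    rw [Finset.mem_Icc] at hg
    have hg0 : 0 < g := hg.1
    have hg0' : (0 : ℝ) < g := by exact_mod_cast hg0
    rw [sum_filter_dvd_Icc hg0 K (fun _ => (1 : ℝ)), Finset.sum_const, Nat.card_Icc, nsmul_eq_mul,
      mul_one, Nat.add_sub_cancel]
    have hdiv : ((K / g : ℕ) : ℝ) ≤ (K : ℝ) / g := Nat.cast_div_le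
    have h0 : (0 : ℝ) ≤ ((K / g : ℕ) : ℝ) := Nat.cast_nonneg _
    calc (g : ℝ) * ((K / g : ℕ) : ℝ) ^ 2 ≤ g * ((K : ℝ) / g) ^ 2 :=
          mul_le_mul_of_nonneg_left (pow_le_pow_left₀ h0 hdiv 2) hg0'.le
      _ = (K : ℝ) ^ 2 * (1 / g) := by field_simp
  calc _ ≤ ∑ g ∈ Finset.Icc 1 K, (K : ℝ) ^ 2 * (1 / g) := Finset.sum_le_sum h2
    _ = (K : ℝ) ^ 2 * ∑ g ∈ Finset.Icc 1 K, (1 : ℝ) / g := by rw [Finset.mul_sum]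
    _ ≤ _ := mul_le_mul_of_nonneg_left (sum_Icc_inv_le_log K) (sq_nonneg _)

/-- **`∑_{a, b ≤ K} (a, b)/(a b) ≤ (1 + log K)³`**. [folklore] -/
theorem sum_sum_gcd_div_le (K : ℕ) :
    ∑ a ∈ Finset.Icc 1 K, ∑ b ∈ Finset.Icc 1 K, (Nat.gcd a b : ℝ) / (a * b) ≤
      (1 + Real.log K) ^ 3 := by
  rcases Nat.eq_zero_or_pos K with rfl | hK
  · simp
  have hlogK : 0 ≤ Real.log K := Real.log_nonneg (by exact_mod_cast hK)
  have h1 : ∑ a ∈ Finset.Icc 1 K, ∑ b ∈ Finset.Icc 1 K, (Nat.gcd a b : ℝ) / (a * b) ≤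
      ∑ a ∈ Finset.Icc 1 K, ∑ b ∈ Finset.Icc 1 K,
        (fun a => (1 : ℝ) / a) a * (fun a => (1 : ℝ) / a) b *
          ∑ g ∈ Finset.Icc 1 K, (if g ∣ a ∧ g ∣ b then (g : ℝ) else 0) := by
    refine Finset.sum_le_sum fun a ha => Finset.sum_le_sum fun b hb => ?_
    have ha' := Finset.mem_Icc.mp ha
    have hb' := Finset.mem_Icc.mp hb
    have ha0 : (0 : ℝ) < a := by exact_mod_cast ha'.1
    have hb0 : (0 : ℝ) < b := by exact_mod_cast hb'.1
    simp only
    calc (Nat.gcd a b : ℝ) / (a * b) = 1 / a * (1 / b) * Nat.gcd a b := by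
          field_simp
      _ ≤ 1 / a * (1 / b) * ∑ g ∈ Finset.Icc 1 K, (if g ∣ a ∧ g ∣ b then (g : ℝ) else 0) :=
          mul_le_mul_of_nonneg_left (gcd_le_sum_ite_dvd ha) (by positivity)
  refine h1.trans ?_
  rw [sum_sum_sum_ite_dvd_eq K (fun g => (g : ℝ)) (fun a => (1 : ℝ) / a)]
  have h2 : ∀ g ∈ Finset.Icc 1 K,
      (g : ℝ) * (∑ a ∈ (Finset.Icc 1 K).filter (fun a => g ∣ a), (fun a => (1 : ℝ) / a) a) ^ 2 ≤
        1 / g * (1 + Real.log K) ^ 2 := by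
    intro g hg
    rw [Finset.mem_Icc] at hg
    have hg0 : 0 < g := hg.1
    have hg0' : (0 : ℝ) < g := by exact_mod_cast hg0
    rw [sum_filter_dvd_Icc hg0 K (fun a => (1 : ℝ) / a)]
    have hinner : ∑ j ∈ Finset.Icc 1 (K / g), (fun a : ℕ => (1 : ℝ) / a) (g * j) =
        1 / g * ∑ j ∈ Finset.Icc 1 (K / g), (1 : ℝ) / j := by
      rw [Finset.mul_sum]
      refine Finset.sum_congr rfl fun j hj => ?_
      have hj0 : (0 : ℝ) < j := by exact_mod_cast (Finset.mem_Icc.mp hj).1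
      simp only
      push_cast
      field_simp
    have hharm : ∑ j ∈ Finset.Icc 1 (K / g), (1 : ℝ) / j ≤ 1 + Real.log K := by
      refine (sum_Icc_inv_le_log (K / g)).trans ?_
      rcases Nat.eq_zero_or_pos (K / g) with h0 | hpos
      · rw [h0]; simp [hlogK]
      · have : Real.log ((K / g : ℕ) : ℝ) ≤ Real.log K :=
          Real.log_le_log (by exact_mod_cast hpos) (by exact_mod_cast Nat.div_le_self K g)
        linarith
    have hh0 : 0 ≤ ∑ j ∈ Finset.Icc 1 (K / g), (1 : ℝ) / j :=
      Finset.sum_nonneg fun _ _ => by positivity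
    rw [hinner]
    calc (g : ℝ) * (1 / g * ∑ j ∈ Finset.Icc 1 (K / g), (1 : ℝ) / j) ^ 2
        = 1 / g * (∑ j ∈ Finset.Icc 1 (K / g), (1 : ℝ) / j) ^ 2 := by
          field_simp
      _ ≤ 1 / g * (1 + Real.log K) ^ 2 :=
          mul_le_mul_of_nonneg_left (pow_le_pow_left₀ hh0 hharm 2) (by positivity)
  calc _ ≤ ∑ g ∈ Finset.Icc 1 K, (1 / g : ℝ) * (1 + Real.log K) ^ 2 := Finset.sum_le_sum h2
    _ = (∑ g ∈ Finset.Icc 1 K, (1 : ℝ) / g) * (1 + Real.log K) ^ 2 := by rw [Finset.sum_mul]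
    _ ≤ (1 + Real.log K) * (1 + Real.log K) ^ 2 :=
        mul_le_mul_of_nonneg_right (sum_Icc_inv_le_log K) (by positivity)
    _ = _ := by ring

/-! ### The logarithmic bound for `κ` -/

/-- `|Λ_Q(E)| ≤ ∑_{b ≤ E} 1/b ≤ 1 + log E`. [folklore] -/
theorem abs_chiSeries_le_log (Q E : ℕ) : |chiSeries Q E| ≤ 1 + Real.log E := by
  unfold chiSeries
  refine (Finset.abs_sum_le_sum_abs _ _).trans ?_
  calc ∑ b ∈ (Ioc 0 E).filter (fun b => b.Coprime Q), |FriedlanderIwaniecPrimes.chi4R b / b|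
      ≤ ∑ b ∈ Ioc 0 E, |FriedlanderIwaniecPrimes.chi4R b / (b : ℝ)| :=
        Finset.sum_le_sum_of_subset_of_nonneg (Finset.filter_subset _ _) fun _ _ _ => abs_nonneg _
    _ ≤ ∑ b ∈ Ioc 0 E, (1 : ℝ) / b := by
        refine Finset.sum_le_sum fun b hb => ?_
        rw [Finset.mem_Ioc] at hb
        have hb0 : (0 : ℝ) < b := by exact_mod_cast hb.1
        rw [abs_div, abs_of_pos hb0]
        exact div_le_div_of_nonneg_right (FriedlanderIwaniecPrimes.abs_chi4R_le_one b) hb0.le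
    _ = ∑ b ∈ Icc 1 E, (1 : ℝ) / b := by
        rw [show Ioc 0 E = Icc 1 E from (Finset.Icc_add_one_left_eq_Ioc 0 E).symm]
    _ ≤ _ := sum_Icc_inv_le_log E

/-- **`|κ| ≤ 2 (1 + log E)`** (`φ(Q)/Q ≤ 1`, `|S_Q(G)| ≤ 2`, `|Λ_Q(E)| ≤ 1 + log E`). [folklore] -/
theorem abs_kappa_le_log (Q G E : ℕ) : |kappa Q G E| ≤ 2 * (1 + Real.log E) := by
  unfold kappa
  rw [abs_mul, abs_mul]
  have h1 : |(Nat.totient Q : ℝ) / Q| ≤ 1 := by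
    rcases Nat.eq_zero_or_pos Q with hQ | hQ
    · subst hQ; simp
    · rw [abs_of_nonneg (by positivity), div_le_one (by exact_mod_cast hQ)]
      exact_mod_cast Nat.totient_le Q
  have h2 := abs_sqfSeries_le Q G
  have h3 := abs_chiSeries_le_log Q E
  have h30 : 0 ≤ 1 + Real.log E := (abs_nonneg _).trans h3
  calc |(Nat.totient Q : ℝ) / Q| * |sqfSeries Q G| * |chiSeries Q E| ≤ 1 * 2 * (1 + Real.log E) :=
        mul_le_mul (mul_le_mul h1 h2 (abs_nonneg _) zero_le_one) h3 (abs_nonneg _) (by norm_num)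
    _ = _ := by ring

end Literature.NumberTheory.Sieve.Iwaniec1978

end
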